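import Summits.AtomisticToContinuum.FouriersLaw.Theorems.BondHeatUncertaintyBoundedResponseBathHeatHorizonReturnA
import HarnessLib

/-!
# BondHeatUncertainty / BoundedResponse — «HorizonReturn» §3: the finite-horizon forecast `U^{s,t;τ}_N`, the HORIZON HEAT-RETURN CURVE `𝔊^{s,t;τ}_N`,
Jensen for kick averages and the FREE `L²` BUDGET (part 2 of 5 — overview in the main file `…BathHeatHorizonReturn`)

Objects: `horizonCumFcast` `U^{s,t;τ}_N(z) = ∫_{(0,τ]} ℓ_{s,t}(u)·(P_u θ₀)(z) du`, `horizonReturnProfile` `𝔊^{s,t;τ}_N(k) = ∫ U^{s,t;τ}_N(q, p[0 ↦ k]) dμ_T`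
(= `kickAvg` of `U^τ`), `bathKinRem` `Rem_N(τ) = ∫_{(τ,∞)} K_N`. Facts: strong measurability, the Harris pointwise bound (integrability only), `U^τ ∈ L²(μ_T)`,
`∫θ₀² dμ_T = ∫(k²−T)² dν_T` (Stein by resampling); ★ `integral_kickAvg_sq_le` (`∫F̄² dν_T ≤ ∫F² dμ_T`: the kick average is a conditional expectation);
★ `integral_horizonCumFcast_sq_le`: `∫(U^{s,t;τ}_N)² dμ_T ≤ (|t|+4|s|)²·τ²·∫(k²−T)² dν_T` (Cauchy–Schwarz in `u`, Fubini, `L²`-contraction of `P_u`) —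
no spectral gap, no corrector budget, no Harris constant in the bound. No `sorry`, no new axioms.
-/

noncomputable section

open MeasureTheory ProbabilityTheory Filter Topology Set Function
open scoped NNReal ENNReal
open Literature.MathematicalPhysics.KineticTheory.HeatConduction
open Literature.MathematicalPhysics.KineticTheory OscillatorChain
open Literature.Probability.Process
open Summit.AtomisticToContinuum.FouriersLaw.Theorems.OddSectorIrreversibility
  (pinnedChain_stronglyMeasurable_act_uncurry pinnedChain_integral_sq_act_le_of_stronglyMeasurable
    pinnedChain_integrable_transitionKernel_of_abs_le integral_exp_neg_mul_Ioi' integrable_mul_of_integrable_sq)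
open Summit.AtomisticToContinuum.FouriersLaw.Theorems.BoundedResponse.ParityFloor
  (kinObs kinAct continuous_kinObs abs_kinObs_le stronglyMeasurable_kinAct abs_kinAct_le kinAct_integrableOn
    harrisBound_exists weight_facts kinObs_sq_facts)

namespace Summit.AtomisticToContinuum.FouriersLaw.Theorems.BoundedResponse.HeatSpreading

/-! ## §3 Finite-horizon objects: `U^{s,t;τ}_N`, the HORIZON HEAT-RETURN CURVE `𝔊^{s,t;τ}_N`, the kernel's horizon remainder -/

section HorizonObjects

variable {ω₂ lam β γ : ℝ} {T : ℝ}

/-- **Finite-horizon late cumulative forecast** `U^{s,t;τ}_N(z) := ∫_{(0,τ]} ℓ_{s,t}(u)·(P_u θ₀)(z) du` — NODE 111's `lateCumFcast` with the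
time integral CUT AT THE HORIZON `τ` (`0` for `N = 0`). Everything about it is finite-time. [new] -/
def horizonCumFcast (ω₂ lam β γ T : ℝ) (N : ℕ) (s t τ : ℝ) (z : PhaseSpace N) : ℝ :=
  if h : 0 < N then ∫ u in Ioc (0 : ℝ) τ, lateWeight s t u * kinAct ω₂ lam β γ T N ⟨0, h⟩ u z else 0

/-- **HORIZON HEAT-RETURN CURVE `𝔊^{s,t;τ}_N(k) := ∫ U^{s,t;τ}_N(q, p[0 ↦ k]) dμ_T`** — the late-time-weighted boundary heat returned WITHIN
TIME `τ` after the bath particle's momentum is set to `k` (kick average of `U^{s,t;τ}_N`; `0` for `N = 0`). [new] -/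
def horizonReturnProfile (ω₂ lam β γ T : ℝ) (N : ℕ) (s t τ k : ℝ) : ℝ :=
  if h : 0 < N then
    ∫ z, horizonCumFcast ω₂ lam β γ T N s t τ ((z.1, Function.update z.2 ⟨0, h⟩ k) : PhaseSpace N)
      ∂((pinnedChain ω₂ lam β γ).gibbsMeasure N T)
  else 0

/-- **Horizon remainder of the boundary kernel** `Rem_N(τ) := ∫_{(τ,∞)} K_N(r) dr` — the ONLY infinite-time quantity of this node. [new] -/
def bathKinRem (ω₂ lam β γ T : ℝ) (N : ℕ) (τ : ℝ) : ℝ :=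
  ∫ r in Ioi τ, bathKinCorr ω₂ lam β γ T N r

/-- `U^{s,t;τ}_{n+1}` unfolded. [formal bookkeeping] -/
theorem horizonCumFcast_succ (ω₂ lam β γ T : ℝ) (n : ℕ) (s t τ : ℝ) (z : PhaseSpace (n + 1)) :
    horizonCumFcast ω₂ lam β γ T (n + 1) s t τ z =
      ∫ u in Ioc (0 : ℝ) τ, lateWeight s t u * kinAct ω₂ lam β γ T (n + 1) 0 u z := by
  unfold horizonCumFcast
  rw [dif_pos (Nat.succ_pos n)]
  rfl

/-- `𝔊^{s,t;τ}_{n+1}` is the kick average of `U^{s,t;τ}_{n+1}`. [formal bookkeeping] -/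
theorem horizonReturnProfile_succ (ω₂ lam β γ T : ℝ) (n : ℕ) (s t τ : ℝ) :
    horizonReturnProfile ω₂ lam β γ T (n + 1) s t τ = kickAvg ω₂ lam β γ T n (horizonCumFcast ω₂ lam β γ T (n + 1) s t τ) := by
  funext k
  unfold horizonReturnProfile kickAvg
  rw [dif_pos (Nat.succ_pos n)]
  rfl

/-- `∫_{(0,τ]} f = ∫_{(0,∞)} 𝟙_{(−∞,τ]}·f`. [formal bookkeeping] -/
theorem setIntegral_Ioc_eq_Ioi_indicator (f : ℝ → ℝ) (τ : ℝ) :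
    ∫ u in Ioc (0 : ℝ) τ, f u = ∫ u in Ioi (0 : ℝ), (Iic τ).indicator f u := by
  rw [setIntegral_indicator measurableSet_Iic, Ioi_inter_Iic]

section Facts

variable (hω : 0 < ω₂) (hl : 0 < lam) (hβ : 0 < β) (hγ : 0 < γ) (hT : 0 < T)
include hω hl hβ hγ hT

omit hT in
/-- `U^{s,t;τ}_{n+1}` is strongly measurable. [folklore] -/
theorem stronglyMeasurable_horizonCumFcast (n : ℕ) (s t τ : ℝ) :
    StronglyMeasurable (horizonCumFcast ω₂ lam β γ T (n + 1) s t τ) := by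
  have h1 := pinnedChain_stronglyMeasurable_act_uncurry hω hl.le hβ.le hγ.le T T (N := n + 1)
    (continuous_kinObs T (0 : Fin (n + 1))).measurable
  have h2 : StronglyMeasurable fun q : ℝ × PhaseSpace (n + 1) => lateWeight s t q.1 :=
    ((continuous_lateWeight s t).measurable.comp measurable_fst).stronglyMeasurable
  have h3 := StronglyMeasurable.integral_prod_left' (μ := volume.restrict (Ioc (0 : ℝ) τ)) (h2.mul h1)
  have e : horizonCumFcast ω₂ lam β γ T (n + 1) s t τ =
      fun z => ∫ u in Ioc (0 : ℝ) τ, lateWeight s t u * kinAct ω₂ lam β γ T (n + 1) 0 u z :=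
    funext (horizonCumFcast_succ ω₂ lam β γ T n s t τ)
  rw [e]
  exact h3

omit hl hβ hγ in
/-- **Pointwise bound**: `|U^{s,t;τ}_{n+1}(z)| ≤ (|t| + 4|s|)·K(2/ϑ+T)/c · e^{ϑH(z)}` (Harris constants; used for integrability ONLY). [folklore] -/
theorem abs_horizonCumFcast_le (hl' : 0 ≤ lam) (hβ' : 0 < β) (hγ' : 0 < γ) {n : ℕ} {ϑ K c : ℝ}
    (hϑ0 : 0 < ϑ) (hb : ∀ (z : PhaseSpace (n + 1)) (t : ℝ≥0) (f : PhaseSpace (n + 1) → ℝ), Continuous f → ∀ C : ℝ, 0 ≤ C →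
      (∀ y, |f y| ≤ C * Real.exp (ϑ * (pinnedChain ω₂ lam β γ).hamiltonian (n + 1) y)) →
      |(∫ y, f y ∂((pinnedChain ω₂ lam β γ).transitionKernel (n + 1) T T t z)) -
          ∫ y, f y ∂((pinnedChain ω₂ lam β γ).gibbsMeasure (n + 1) T)| ≤
        K * C * Real.exp (ϑ * (pinnedChain ω₂ lam β γ).hamiltonian (n + 1) z) * Real.exp (-c * t)) (hc : 0 < c)
    (s t τ : ℝ) (z : PhaseSpace (n + 1)) :
    |horizonCumFcast ω₂ lam β γ T (n + 1) s t τ z| ≤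
      (|t| + 4 * |s|) * (K * (2 / ϑ + T)) / c * Real.exp (ϑ * (pinnedChain ω₂ lam β γ).hamiltonian (n + 1) z) := by
  rw [horizonCumFcast_succ]
  obtain ⟨-, hpt⟩ := kinAct_integrableOn hω hl' hβ' hγ' hT hϑ0 hb hc (0 : Fin (n + 1)) z
  set E := Real.exp (ϑ * (pinnedChain ω₂ lam β γ).hamiltonian (n + 1) z) with hE
  set W := |t| + 4 * |s| with hWdef
  have hK0 : 0 ≤ K * (2 / ϑ + T) * E := by
    have h := hpt 0 le_rfl
    rw [mul_zero, Real.exp_zero, mul_one] at h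
    exact (abs_nonneg _).trans h
  have hdecay' : IntegrableOn (fun u : ℝ => W * (K * (2 / ϑ + T)) * E * Real.exp (-c * u)) (Ioi 0) :=
    (exp_neg_integrableOn_Ioi 0 hc).const_mul _
  have hdecay : IntegrableOn (fun u : ℝ => W * (K * (2 / ϑ + T)) * E * Real.exp (-c * u)) (Ioc 0 τ) :=
    hdecay'.mono_set Ioc_subset_Ioi_self
  have hbd : ∀ᵐ u ∂(volume.restrict (Ioc (0 : ℝ) τ)),
      ‖lateWeight s t u * kinAct ω₂ lam β γ T (n + 1) 0 u z‖ ≤ W * (K * (2 / ϑ + T)) * E * Real.exp (-c * u) :=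
    (ae_restrict_iff' measurableSet_Ioc).2 (Eventually.of_forall fun u hu => by
      rw [norm_mul, Real.norm_eq_abs, Real.norm_eq_abs]
      have h1 := hpt u (le_of_lt hu.1)
      have h2 := abs_lateWeight_le s t (le_of_lt hu.1)
      calc |lateWeight s t u| * |kinAct ω₂ lam β γ T (n + 1) 0 u z|
          ≤ W * (K * (2 / ϑ + T) * E * Real.exp (-c * u)) := mul_le_mul h2 h1 (abs_nonneg _) ((abs_nonneg _).trans h2)
        _ = W * (K * (2 / ϑ + T)) * E * Real.exp (-c * u) := by ring)
  have h := norm_integral_le_of_norm_le hdecay hbd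
  have hmono : ∫ u in Ioc (0 : ℝ) τ, W * (K * (2 / ϑ + T)) * E * Real.exp (-c * u) ≤
      ∫ u in Ioi (0 : ℝ), W * (K * (2 / ϑ + T)) * E * Real.exp (-c * u) :=
    setIntegral_mono_set hdecay' (Eventually.of_forall fun u => by
        have hW0 : 0 ≤ W := by positivity
        have : 0 ≤ W * (K * (2 / ϑ + T)) * E := by rw [mul_assoc]; exact mul_nonneg hW0 hK0
        exact mul_nonneg this (Real.exp_nonneg _))
      (Eventually.of_forall Ioc_subset_Ioi_self)
  rw [Real.norm_eq_abs] at h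
  have hR : ∫ u in Ioi (0 : ℝ), W * (K * (2 / ϑ + T)) * E * Real.exp (-c * u) = W * (K * (2 / ϑ + T)) * E * (1 / c) := by
    rw [integral_const_mul, integral_exp_neg_mul_Ioi' hc]
  calc _ ≤ _ := h
    _ ≤ _ := hmono
    _ = W * (K * (2 / ϑ + T)) * E * (1 / c) := hR
    _ = W * (K * (2 / ϑ + T)) / c * E := by ring

/-- **`U^{s,t;τ}_{n+1} ∈ L²(μ_T)` and `θ₀·U^{s,t;τ}_{n+1} ∈ L¹(μ_T)`.** [folklore] -/
theorem horizonCumFcast_sq_facts (n : ℕ) (s t τ : ℝ) :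
    Integrable (fun z => horizonCumFcast ω₂ lam β γ T (n + 1) s t τ z ^ 2) ((pinnedChain ω₂ lam β γ).gibbsMeasure (n + 1) T) ∧
    Integrable (fun z : PhaseSpace (n + 1) => (z.2 0 ^ 2 - T) * horizonCumFcast ω₂ lam β γ T (n + 1) s t τ z)
      ((pinnedChain ω₂ lam β γ).gibbsMeasure (n + 1) T) := by
  obtain ⟨hϑ0, h2ϑ, hϑ1⟩ := weight_facts hT
  obtain ⟨K, c, hK0, hc, hb⟩ := harrisBound_exists hω hl.le hβ hγ (Nat.succ_pos n) hT hϑ0 hϑ1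
  have hUm := stronglyMeasurable_horizonCumFcast (T := T) hω hl hβ hγ n s t τ
  have hU2 := (pinnedChain_integral_sq_act_le_of_stronglyMeasurable hω hl.le hβ hγ (Nat.succ_pos n) hT hϑ0 h2ϑ hUm
    (abs_horizonCumFcast_le hω hT hl.le hβ hγ hϑ0 hb hc s t τ) 0).1
  obtain ⟨hθm, hθ2⟩ := kinObs_sq_facts hω hl.le hβ hγ (Nat.succ_pos n) hT (0 : Fin (n + 1))
  exact ⟨hU2, integrable_mul_of_integrable_sq hθm.aestronglyMeasurable hUm.aestronglyMeasurable hθ2 hU2⟩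

/-- `∫ θ₀² dμ_T = ∫ (k² − T)² dν_T` — the budget's only constant is a 1-D Gaussian moment (independent of `N`; Stein by resampling). [folklore] -/
theorem integral_kinObs_sq_eq_gaussT (n : ℕ) :
    ∫ z, kinObs T (n + 1) 0 z ^ 2 ∂((pinnedChain ω₂ lam β γ).gibbsMeasure (n + 1) T) =
      ∫ k, (k ^ 2 - T) ^ 2 ∂(gaussianReal 0 T.toNNReal) := by
  haveI := pinnedChain_isProbabilityMeasure_gibbsMeasure hω hl.le hβ.le γ (n + 1) hT
  obtain ⟨hθm, hθ2⟩ := kinObs_sq_facts hω hl.le hβ hγ (Nat.succ_pos n) hT (0 : Fin (n + 1))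
  have hI : Integrable (fun z : PhaseSpace (n + 1) => (z.2 0 ^ 2 - T) * kinObs T (n + 1) 0 z)
      ((pinnedChain ω₂ lam β γ).gibbsMeasure (n + 1) T) :=
    hθ2.congr (ae_of_all _ fun z => by simp only [kinObs]; ring)
  have h := (integral_kinObs_mul_eq_kickAvg hω hl.le hβ.le hT hθm.measurable hI).2
  have hk : ∀ k : ℝ, kickAvg ω₂ lam β γ T n (kinObs T (n + 1) 0) k = k ^ 2 - T := by
    intro k
    simp only [kickAvg, kinObs, Function.update_self, integral_const, probReal_univ, smul_eq_mul, one_mul]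
  simp_rw [hk] at h
  calc ∫ z, kinObs T (n + 1) 0 z ^ 2 ∂((pinnedChain ω₂ lam β γ).gibbsMeasure (n + 1) T)
      = ∫ z : PhaseSpace (n + 1), (z.2 0 ^ 2 - T) * kinObs T (n + 1) 0 z ∂((pinnedChain ω₂ lam β γ).gibbsMeasure (n + 1) T) :=
        integral_congr_ae (ae_of_all _ fun z => by simp only [kinObs]; ring)
    _ = ∫ k, (k ^ 2 - T) * (k ^ 2 - T) ∂(gaussianReal 0 T.toNNReal) := h.symm
    _ = _ := integral_congr_ae (ae_of_all _ fun k => by ring)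

omit hγ in
/-- ★ **JENSEN FOR KICK AVERAGES**: `∫ F̄(k)² dν_T ≤ ∫ F² dμ_T` and `F̄² ∈ L¹(ν_T)` for measurable `F ∈ L²(μ_T)` — the kick average is a
conditional expectation (`p₀` is an independent `N(0,T)` coordinate of `μ_T`). [folklore mechanism; this cell] -/
theorem integral_kickAvg_sq_le {n : ℕ} {F : PhaseSpace (n + 1) → ℝ} (hF : Measurable F)
    (hF2 : Integrable (fun z => F z ^ 2) ((pinnedChain ω₂ lam β γ).gibbsMeasure (n + 1) T)) :
    Integrable (fun k => kickAvg ω₂ lam β γ T n F k ^ 2) (gaussianReal 0 T.toNNReal) ∧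
      ∫ k, kickAvg ω₂ lam β γ T n F k ^ 2 ∂(gaussianReal 0 T.toNNReal) ≤
        ∫ z, F z ^ 2 ∂((pinnedChain ω₂ lam β γ).gibbsMeasure (n + 1) T) := by
  set μ := (pinnedChain ω₂ lam β γ).gibbsMeasure (n + 1) T with hμ
  set ν := gaussianReal 0 T.toNNReal with hν
  haveI : IsProbabilityMeasure μ := pinnedChain_isProbabilityMeasure_gibbsMeasure hω hl.le hβ.le γ (n + 1) hT
  -- the mean of `F²`'s kick average
  obtain ⟨hGi, hGe⟩ := integral_kickAvg hω hl.le hβ.le hT (hF.pow_const 2) hF2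
  -- product integrability of `(k, w) ↦ F(q, p[0 ↦ k])²`
  set H : ℝ × PhaseSpace (n + 1) → ℝ := fun x => F (x.2.1, Function.update x.2.2 0 x.1) ^ 2 with hH
  have hHm : Measurable H := (hF.comp (measurable_setMomentum n)).pow_const 2
  have hΦ := PhononMeanFreePath.lightCone_gibbs_map_momentum_resample (γ := γ) hω hl.le hβ.le hT (0 : Fin (n + 1)) (n := n)
  have hΦm : Measurable fun x : PhaseSpace (n + 1) × ℝ =>
      (x.1.2 0, ((x.1.1, Function.update x.1.2 0 x.2) : PhaseSpace (n + 1))) :=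
    ((measurable_pi_apply 0).comp (measurable_snd.comp measurable_fst)).prodMk
      (PhononMeanFreePath.lightCone_measurable_resample 0)
  have hcomp : ∀ x : PhaseSpace (n + 1) × ℝ,
      H (x.1.2 0, ((x.1.1, Function.update x.1.2 0 x.2) : PhaseSpace (n + 1))) = F x.1 ^ 2 := by
    intro x
    simp only [hH, Function.update_idem, Function.update_eq_self, Prod.mk.eta]
  have hIH : Integrable H (ν.prod μ) := by
    rw [hν, hμ, ← hΦ, integrable_map_measure hHm.aestronglyMeasurable hΦm.aemeasurable]
    exact (hF2.comp_fst (gaussianReal 0 T.toNNReal)).congr (ae_of_all _ fun x => (hcomp x).symm)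
  -- a.e. section integrability and the pointwise Jensen
  have hsec := hIH.prod_right_ae
  have hsm : ∀ k : ℝ, Measurable fun w : PhaseSpace (n + 1) => F (w.1, Function.update w.2 0 k) := fun k =>
    hF.comp ((measurable_setMomentum n).comp (measurable_const.prodMk measurable_id))
  have hpt : ∀ᵐ k ∂ν, kickAvg ω₂ lam β γ T n F k ^ 2 ≤ kickAvg ω₂ lam β γ T n (fun z => F z ^ 2) k := by
    filter_upwards [hsec] with k hk
    simp only [kickAvg]
    exact sq_integral_le_integral_sq_of_prob (hsm k).aestronglyMeasurable (by simpa [hH] using hk)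
  -- measurability of the kick average
  have hKm : StronglyMeasurable (kickAvg ω₂ lam β γ T n F) := by
    have h1 : StronglyMeasurable (fun x : ℝ × PhaseSpace (n + 1) => F (x.2.1, Function.update x.2.2 0 x.1)) :=
      (hF.comp (measurable_setMomentum n)).stronglyMeasurable
    exact StronglyMeasurable.integral_prod_right' (ν := μ) h1
  have hInt : Integrable (fun k => kickAvg ω₂ lam β γ T n F k ^ 2) ν := by
    refine hGi.mono' (hKm.aestronglyMeasurable.pow 2) ?_
    filter_upwards [hpt] with k hk
    rw [Real.norm_eq_abs, abs_of_nonneg (sq_nonneg _)]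
    exact hk
  refine ⟨hInt, ?_⟩
  calc ∫ k, kickAvg ω₂ lam β γ T n F k ^ 2 ∂ν ≤ ∫ k, kickAvg ω₂ lam β γ T n (fun z => F z ^ 2) k ∂ν :=
        integral_mono_ae hInt hGi hpt
    _ = ∫ z, F z ^ 2 ∂μ := hGe

/-- ★ **THE FREE BUDGET**: `∫ (U^{s,t;τ}_{n+1})² dμ_T ≤ (|t| + 4|s|)²·τ²·∫(k²−T)² dν_T` (`τ ≥ 0`) — Cauchy–Schwarz in the time variable on
`(0,τ]`, Fubini, and the `L²(μ_T)`-contraction of the dynamics; NO spectral gap, NO corrector budget, NO Harris constant. [this cell] -/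
theorem integral_horizonCumFcast_sq_le (n : ℕ) (s t : ℝ) {τ : ℝ} (hτ : 0 ≤ τ) :
    ∫ z, horizonCumFcast ω₂ lam β γ T (n + 1) s t τ z ^ 2 ∂((pinnedChain ω₂ lam β γ).gibbsMeasure (n + 1) T) ≤
      (|t| + 4 * |s|) ^ 2 * τ ^ 2 * ∫ k, (k ^ 2 - T) ^ 2 ∂(gaussianReal 0 T.toNNReal) := by
  set μ := (pinnedChain ω₂ lam β γ).gibbsMeasure (n + 1) T with hμ
  set Lτ := volume.restrict (Ioc (0 : ℝ) τ) with hLτ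
  haveI : IsProbabilityMeasure μ := pinnedChain_isProbabilityMeasure_gibbsMeasure hω hl.le hβ.le γ (n + 1) hT
  obtain ⟨ϑ, hϑ⟩ : ∃ ϑ : ℝ, ϑ = 1 / (4 * T) := ⟨_, rfl⟩
  obtain ⟨hϑ0, h2ϑ, hϑ1⟩ : 0 < ϑ ∧ 2 * ϑ < 1 / T ∧ ϑ < 1 / T := by rw [hϑ]; exact weight_facts hT
  obtain ⟨K, c, hK0, hc, hb⟩ := harrisBound_exists hω hl.le hβ hγ (Nat.succ_pos n) hT hϑ0 hϑ1
  set W := |t| + 4 * |s| with hW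
  set Cv := K * (2 / ϑ + T) with hCv
  have hCv0 : 0 ≤ Cv := by positivity
  set K0 := ∫ k, (k ^ 2 - T) ^ 2 ∂(gaussianReal 0 T.toNNReal) with hK0def
  -- (a) the boundary heat observable: `∫ v_u² dμ ≤ ∫ θ₀² dμ = K0`
  have hθsq := integral_kinObs_sq_eq_gaussT hω hl hβ hγ hT n
  have hcontr : ∀ u : ℝ, Integrable (fun z => kinAct ω₂ lam β γ T (n + 1) 0 u z ^ 2) μ ∧
      ∫ z, kinAct ω₂ lam β γ T (n + 1) 0 u z ^ 2 ∂μ ≤ K0 := by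
    intro u
    have h := pinnedChain_integral_sq_act_le_of_stronglyMeasurable hω hl.le hβ hγ (Nat.succ_pos n) hT hϑ0 h2ϑ
      (continuous_kinObs T (0 : Fin (n + 1))).stronglyMeasurable
      (fun y => abs_kinObs_le (γ := γ) hω hl.le hβ.le hT.le hϑ0 (0 : Fin (n + 1)) y) u.toNNReal
    refine ⟨h.2.1, ?_⟩
    rw [hK0def, ← hθsq]
    exact h.2.2
  -- (b) joint measurability and the dominated square on `μ ⊗ Leb|(0,τ]`
  have hSMuz := pinnedChain_stronglyMeasurable_act_uncurry hω hl.le hβ.le hγ.le T T (N := n + 1)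
    (continuous_kinObs T (0 : Fin (n + 1))).measurable
  have hvb : ∀ (u : ℝ) (z : PhaseSpace (n + 1)), |kinAct ω₂ lam β γ T (n + 1) 0 u z| ≤
      Cv * Real.exp (ϑ * (pinnedChain ω₂ lam β γ).hamiltonian (n + 1) z) := by
    intro u z
    have h := abs_kinAct_le hω hl.le hβ.le hT hϑ0 hb (0 : Fin (n + 1)) u z
    have h1 : Real.exp (-c * (u.toNNReal : ℝ)) ≤ 1 := by
      rw [Real.exp_le_one_iff]; nlinarith [hc, (u.toNNReal).coe_nonneg]
    calc _ ≤ _ := h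
      _ ≤ K * (2 / ϑ + T) * Real.exp (ϑ * (pinnedChain ω₂ lam β γ).hamiltonian (n + 1) z) * 1 := by gcongr
      _ = _ := by rw [hCv, mul_one]
  set G : PhaseSpace (n + 1) × ℝ → ℝ := fun p => kinAct ω₂ lam β γ T (n + 1) 0 p.2 p.1 ^ 2 with hG
  have hGm : StronglyMeasurable G := (hSMuz.comp_measurable measurable_swap).pow 2
  have hexp2 := pinnedChain_integrable_exp_mul_hamiltonian_gibbsMeasure hω hl.le hβ.le γ (n + 1) hT h2ϑ
  have hDom : Integrable (fun p : PhaseSpace (n + 1) × ℝ =>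
      Cv ^ 2 * Real.exp (2 * ϑ * (pinnedChain ω₂ lam β γ).hamiltonian (n + 1) p.1)) (μ.prod Lτ) :=
    (hexp2.const_mul (Cv ^ 2)).comp_fst Lτ
  have hGI : Integrable G (μ.prod Lτ) := by
    refine hDom.mono' hGm.aestronglyMeasurable (Eventually.of_forall fun p => ?_)
    rw [Real.norm_eq_abs, hG]; simp only
    rw [abs_of_nonneg (sq_nonneg _)]
    have h := hvb p.2 p.1
    have e : Cv ^ 2 * Real.exp (2 * ϑ * (pinnedChain ω₂ lam β γ).hamiltonian (n + 1) p.1) =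
        (Cv * Real.exp (ϑ * (pinnedChain ω₂ lam β γ).hamiltonian (n + 1) p.1)) ^ 2 := by
      have e2 : 2 * ϑ * (pinnedChain ω₂ lam β γ).hamiltonian (n + 1) p.1 =
          ϑ * (pinnedChain ω₂ lam β γ).hamiltonian (n + 1) p.1 + ϑ * (pinnedChain ω₂ lam β γ).hamiltonian (n + 1) p.1 := by ring
      rw [e2, Real.exp_add]; ring
    rw [e, ← sq_abs]
    exact pow_le_pow_left₀ (abs_nonneg _) h 2
  -- (c) Fubini: `∫∫ v² du dμ = ∫∫ v² dμ du ≤ τ·K0`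
  have hFub : ∫ z, ∫ u, G (z, u) ∂Lτ ∂μ = ∫ u, ∫ z, G (z, u) ∂μ ∂Lτ :=
    integral_integral_swap (f := fun z u => G (z, u)) hGI
  have hinner : ∫ u, ∫ z, G (z, u) ∂μ ∂Lτ ≤ τ * K0 := by
    have hIu : Integrable (fun u => ∫ z, G (z, u) ∂μ) Lτ := hGI.swap.integral_prod_left
    have hle : ∀ u, ∫ z, G (z, u) ∂μ ≤ K0 := fun u => (hcontr u).2
    calc ∫ u, ∫ z, G (z, u) ∂μ ∂Lτ ≤ ∫ _u, K0 ∂Lτ := integral_mono hIu (integrable_const _) hle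
      _ = τ * K0 := by
          rw [integral_const, smul_eq_mul, hLτ, measureReal_restrict_apply_univ, Real.volume_real_Ioc_of_le hτ, sub_zero]
  -- (d) Cauchy–Schwarz in `u` for each microstate
  have hℓ2 : Integrable (fun u => lateWeight s t u ^ 2) Lτ := ((continuous_lateWeight s t).pow 2).integrableOn_Ioc
  have hℓ2le : ∫ u, lateWeight s t u ^ 2 ∂Lτ ≤ W ^ 2 * τ := by
    have h1 : ∫ u in Ioc (0 : ℝ) τ, lateWeight s t u ^ 2 ≤ ∫ _u in Ioc (0 : ℝ) τ, W ^ 2 := by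
      refine setIntegral_mono_on hℓ2 (continuous_const : Continuous fun _ : ℝ => W ^ 2).integrableOn_Ioc measurableSet_Ioc
        fun u hu => ?_
      have h := abs_lateWeight_le s t (le_of_lt hu.1)
      rw [← sq_abs]
      exact pow_le_pow_left₀ (abs_nonneg _) h 2
    rw [setIntegral_const, smul_eq_mul, Real.volume_real_Ioc_of_le hτ, sub_zero] at h1
    rw [hLτ]; linarith
  have hCS : ∀ z : PhaseSpace (n + 1), horizonCumFcast ω₂ lam β γ T (n + 1) s t τ z ^ 2 ≤
      W ^ 2 * τ * ∫ u, G (z, u) ∂Lτ := by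
    intro z
    rw [horizonCumFcast_succ]
    have hvm : AEStronglyMeasurable (fun u => kinAct ω₂ lam β γ T (n + 1) 0 u z) Lτ :=
      (hSMuz.comp_measurable (measurable_id.prodMk measurable_const)).aestronglyMeasurable
    have hv2 : Integrable (fun u => kinAct ω₂ lam β γ T (n + 1) 0 u z ^ 2) Lτ := by
      refine (integrable_const ((Cv * Real.exp (ϑ * (pinnedChain ω₂ lam β γ).hamiltonian (n + 1) z)) ^ 2)).mono'
        (hvm.pow 2) (Eventually.of_forall fun u => ?_)
      rw [Real.norm_eq_abs, abs_of_nonneg (sq_nonneg _), ← sq_abs]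
      exact pow_le_pow_left₀ (abs_nonneg _) (hvb u z) 2
    have h := sq_integral_mul_le_integral_sq_mul (continuous_lateWeight s t).aestronglyMeasurable hvm hℓ2 hv2
    have hG0 : 0 ≤ ∫ u, G (z, u) ∂Lτ := integral_nonneg fun u => sq_nonneg _
    calc (∫ u, lateWeight s t u * kinAct ω₂ lam β γ T (n + 1) 0 u z ∂Lτ) ^ 2
        ≤ (∫ u, lateWeight s t u ^ 2 ∂Lτ) * ∫ u, kinAct ω₂ lam β γ T (n + 1) 0 u z ^ 2 ∂Lτ := h
      _ ≤ (W ^ 2 * τ) * ∫ u, G (z, u) ∂Lτ := mul_le_mul_of_nonneg_right hℓ2le hG0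
  -- (e) integrate over `μ_T`
  have hU2 := (horizonCumFcast_sq_facts hω hl hβ hγ hT n s t τ).1
  have hIz : Integrable (fun z => ∫ u, G (z, u) ∂Lτ) μ := hGI.integral_prod_left
  calc ∫ z, horizonCumFcast ω₂ lam β γ T (n + 1) s t τ z ^ 2 ∂μ ≤ ∫ z, W ^ 2 * τ * ∫ u, G (z, u) ∂Lτ ∂μ :=
        integral_mono hU2 (hIz.const_mul _) hCS
    _ = W ^ 2 * τ * ∫ u, ∫ z, G (z, u) ∂μ ∂Lτ := by rw [integral_const_mul, hFub]
    _ ≤ W ^ 2 * τ * (τ * K0) := mul_le_mul_of_nonneg_left hinner (by positivity)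
    _ = W ^ 2 * τ ^ 2 * K0 := by ring

end Facts

end HorizonObjects

end Summit.AtomisticToContinuum.FouriersLaw.Theorems.BoundedResponse.HeatSpreading

end
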